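import Literature.IUT.LogVolume.ArchimedeanTensorCopiesProofs
import Mathlib.Analysis.InnerProductSpace.LinearMap
import Mathlib.Analysis.Complex.Circle
import HarnessLib

/-!
# [IUTchIV] Proposition 1.5 (iii): proofs, III — invariance under the induced primitive automorphisms

Mochizuki, *Inter-universal Teichmüller theory IV*, RIMS manuscript (Apr. 2020; = PRIMS **57** (2021)),
§1, Proposition 1.5 (iii), pp. 15–16 (kurims `paper:url-56bcb0f95768`): "the tensor product metric on
`M_I`, the direct sum decomposition of `M_I`, the direct sum metric on `M_I`, and the integral structure
`B_I ⊆ M_I` are preserved by the automorphisms of `M_I` induced by the various primitive automorphisms of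
the direct summands “`ℂ_v`” that appear in the factors “`M_i`” of the tensor product `M_I`." PROOF-ONLY
companion of `ArchimedeanTensorCopies` / `ArchimedeanTensorCopiesProofs`; classical content. We prove the
clause for EVERY family `σ = (σ_{i,v})` of `ℝ`-linear isometries of the summands `ℂ_v` (each is
`z ↦ u·z` or `z ↦ u·z̄` with `|u| = 1`, Mathlib `linear_isometry_complex`; the primitive automorphisms are
the case `u⁴ = 1`), which contains the printed statement:

* `character_comp_induced` — `χ_{w,ε} ∘ F_σ = c·χ_{w,ε'}` with `|c| = 1` (the characters are permuted
  up to unimodular scalars); `tensorMetric_induced` — the tensor product metric is preserved;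
* `preservesDecomposition_induced` — every direct sum decomposition is preserved (`F_σ` permutes the
  copies of `ℂ`, acting on each by an isometry of `ℂ`); `dsNormSq_induced` (direct sum metric),
  `mapsTo_ball_induced` / `image_ball_induced` (`F_σ(B_I) = B_I`; the inverse family gives `F_σ⁻¹`);
* **`prop15iii_preserved_holds : Prop15iii_preserved I V`**;
* `mem_ball_iff_forall_character` — `B_I = {x | ∀ w ε, |χ_{w,ε}(x)| ≤ 1}` for every decomposition (so
  `B_I` can be consumed without choosing a decomposition; audit note F-Sd1-1 of abc-iut-S-d1, whose
  parallel model `ArchimedeanTensorPackets` (handed over 2026-08-25) informed `character_comp_induced`).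

With `ArchimedeanTensorCopiesProofs` (`prop15iv_holds`, `prop15iii_unique_holds`,
`card_eq_of_decomposition`) and `ArchimedeanTensorCopiesDecomposition` (`prop15iii_decomposition_holds`,
`prop15iii_metric_holds`) every named statement of [IUTchIV] Prop. 1.5 (iii), (iv) is proved. Nothing
here takes a side on [IUTchIII] Cor. 3.12.
-/

noncomputable section

namespace Literature.IUT.LogVolume

namespace Prop15iii

open scoped TensorProduct ComplexConjugate
open Complex PiTensorProduct

variable (I V : Type) [Fintype I] [DecidableEq I] [Fintype V] [DecidableEq V]

/-! ## Isometries of `ℂ` and their effect on the characters -/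

omit [Fintype I] [DecidableEq I] [Fintype V] [DecidableEq V] in
/-- `cj b ∘ cj b' = cj (b ⊻ b')`. [claim: Mochizuki2012, status: disputed] -/
theorem cj_cj (b b' : Bool) (z : ℂ) : cj b (cj b' z) = cj (xor b b') z := by
  cases b <;> cases b' <;> simp

omit [Fintype I] [DecidableEq I] [Fintype V] [DecidableEq V] in
/-- Every `ℝ`-linear isometry of `ℂ` — in particular every primitive automorphism — is
`z ↦ u·cj(δ)(z)` with `|u| = 1` (Mathlib `linear_isometry_complex`). [claim: Mochizuki2012, status: disputed] -/
theorem exists_unit_cj (σ : ℂ ≃ₗᵢ[ℝ] ℂ) : ∃ (u : ℂ) (δ : Bool), ‖u‖ = 1 ∧ ∀ z, σ z = u * cj δ z := by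
  obtain ⟨a, h | h⟩ := linear_isometry_complex σ
  · exact ⟨a, false, a.norm_coe, fun z => by simp [h, rotation_apply]⟩
  · exact ⟨a, true, a.norm_coe, fun z => by simp [h, rotation_apply, conjLIE_apply]⟩

omit [Fintype I] [DecidableEq I] [Fintype V] [DecidableEq V] in
/-- Conversely `z ↦ u·cj(b)(z)` (`|u| = 1`) is an `ℝ`-linear isometry of `ℂ`. [claim: Mochizuki2012, status: disputed] -/
theorem exists_isometry_eq_unit_cj (u : ℂ) (hu : ‖u‖ = 1) (b : Bool) :
    ∃ τ : ℂ ≃ₗᵢ[ℝ] ℂ, ∀ z, τ z = u * cj b z := by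
  refine ⟨(if b then conjLIE else LinearIsometryEquiv.refl ℝ ℂ).trans
    (rotation ⟨u, mem_sphere_zero_iff_norm.2 hu⟩), fun z => ?_⟩
  cases b <;> simp [rotation_apply, conjLIE_apply]

omit [DecidableEq I] [Fintype V] [DecidableEq V] in
/-- **The characters are permuted, up to unimodular scalars, by the induced automorphisms**:
`χ_{w,ε} ∘ F_σ = c·χ_{w,ε'}` with `|c| = 1` (`ε'_i = ε_i ⊻ δ_{i,w_i}` where `σ_{i,v} = u·cj(δ_{i,v})`).
[claim: Mochizuki2012, status: disputed] -/
theorem character_comp_induced (σ : I → V → (ℂ ≃ₗᵢ[ℝ] ℂ)) (w : I → V) (ε : I → Bool) :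
    ∃ (c : ℂ) (ε' : I → Bool), ‖c‖ = 1 ∧
      (character I V w ε).toLinearMap ∘ₗ induced I V σ = c • (character I V w ε').toLinearMap := by
  choose u δ hu hσ using fun i v => exists_unit_cj (σ i v)
  refine ⟨∏ i, cj (ε i) (u i (w i)), fun i => xor (ε i) (δ i (w i)), by simp [norm_prod, hu], ?_⟩
  refine PiTensorProduct.ext (MultilinearMap.ext fun m => ?_)
  simp [hσ, map_mul, cj_cj, Finset.prod_mul_distrib]

/-! ## (iii): the tensor product metric is preserved -/

omit [DecidableEq I] [DecidableEq V] in
/-- The induced automorphisms preserve the tensor product metric (each `σ_{i,v}` is an isometry of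
`ℂ_v`; compare on pure tensors). [claim: Mochizuki2012, status: disputed] -/
theorem tensorMetric_induced (σ : I → V → (ℂ ≃ₗᵢ[ℝ] ℂ)) {B : MI I V →ₗ[ℝ] MI I V →ₗ[ℝ] ℝ}
    (hB : IsTensorMetric I V B) (x y : MI I V) : B (induced I V σ x) (induced I V σ y) = B x y := by
  suffices h : B.compl₁₂ (induced I V σ) (induced I V σ) = B from
    congrArg (fun B' : MI I V →ₗ[ℝ] MI I V →ₗ[ℝ] ℝ => B' x y) h
  refine PiTensorProduct.ext (MultilinearMap.ext fun m => PiTensorProduct.ext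
    (MultilinearMap.ext fun m' => ?_))
  simp only [LinearMap.compMultilinearMap_apply, LinearMap.compl₁₂_apply, induced_tprod]
  rw [hB, hB]
  refine Finset.prod_congr rfl fun i _ => ?_
  simp [dsInner, LinearIsometryEquiv.inner_map_map]

/-! ## (iii): the decomposition, the direct sum metric and `B_I` are preserved -/

omit [Fintype I] [DecidableEq I] [Fintype V] [DecidableEq V] in
/-- The induced automorphism of the inverse family is a two-sided inverse.
[claim: Mochizuki2012, status: disputed] -/
theorem induced_symm_apply (σ : I → V → (ℂ ≃ₗᵢ[ℝ] ℂ)) (x : MI I V) :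
    induced I V (fun i v => (σ i v).symm) (induced I V σ x) = x := by
  suffices h : induced I V (fun i v => (σ i v).symm) ∘ₗ induced I V σ = LinearMap.id from
    congrArg (fun f : MI I V →ₗ[ℝ] MI I V => f x) h
  refine PiTensorProduct.ext (MultilinearMap.ext fun m => ?_)
  simp only [LinearMap.compMultilinearMap_apply, LinearMap.comp_apply, induced_tprod,
    LinearMap.id_apply]
  congr 1
  funext i v
  simp

omit [Fintype I] [DecidableEq I] [Fintype V] [DecidableEq V] in
/-- The induced automorphisms are surjective. [claim: Mochizuki2012, status: disputed] -/
theorem induced_surjective (σ : I → V → (ℂ ≃ₗᵢ[ℝ] ℂ)) : Function.Surjective (induced I V σ) := by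
  intro y
  refine ⟨induced I V (fun i v => (σ i v).symm) y, ?_⟩
  have := induced_symm_apply I V (fun i v => (σ i v).symm) y
  simpa using this

variable {I V} in
/-- **The induced automorphisms preserve every direct sum decomposition**: they permute the copies of
`ℂ`, acting on each by an isometry of `ℂ`. [claim: Mochizuki2012, status: disputed] -/
theorem preservesDecomposition_induced {J : Type} [Fintype J] [DecidableEq J]
    (Φ : Decomposition I V J) (σ : I → V → (ℂ ≃ₗᵢ[ℝ] ℂ)) :
    PreservesDecomposition Φ (induced I V σ) := by
  -- each coordinate of `Φ ∘ F` is an isometric image of some coordinate of `Φ`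
  have key : ∀ j : J, ∃ (g : J) (u : ℂ ≃ₗᵢ[ℝ] ℂ), ∀ x, Φ (induced I V σ x) j = u (Φ x g) := by
    intro j
    obtain ⟨w, ε, hj⟩ := exists_coord_eq_character Φ j
    obtain ⟨c, ε', hc, hF⟩ := character_comp_induced I V σ w ε
    -- the character `χ_{w,ε'}`, read through `Φ`, is `cj b ∘ (coordinate g)`
    obtain ⟨g, b, hg⟩ := algHom_pi_eq J ((character I V w ε').comp (Φ.symm : (J → ℂ) →ₐ[ℝ] MI I V))
    obtain ⟨τ, hτ⟩ := exists_isometry_eq_unit_cj c hc b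
    refine ⟨g, τ, fun x => ?_⟩
    have h1 := congrArg (fun f : MI I V →ₗ[ℝ] ℂ => f x) hF
    have h2 := hg (Φ x)
    simp only [LinearMap.comp_apply, AlgHom.toLinearMap_apply, LinearMap.smul_apply,
      AlgHom.comp_apply, AlgEquiv.coe_toAlgHom, AlgEquiv.symm_apply_apply] at h1 h2
    rw [hj, h1, h2, hτ, smul_eq_mul]
  choose g u hgu using key
  have hg : Function.Injective g := by
    intro j₁ j₂ hj
    by_contra hne
    obtain ⟨x, hx⟩ := induced_surjective I V σ (Φ.symm (Pi.single j₁ 1))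
    have h1 := hgu j₁ x
    have h2 := hgu j₂ x
    rw [hx, AlgEquiv.apply_symm_apply, Pi.single_eq_same] at h1
    rw [hx, AlgEquiv.apply_symm_apply, Pi.single_eq_of_ne' hne] at h2
    have h1' := congrArg (fun z : ℂ => ‖z‖) h1
    have h2' := congrArg (fun z : ℂ => ‖z‖) h2
    simp only [norm_one, norm_zero, LinearIsometryEquiv.norm_map, hj] at h1' h2'
    rw [← h2'] at h1'
    exact one_ne_zero h1'
  have hgb : Function.Bijective g := Finite.injective_iff_bijective.mp hg
  refine ⟨(Equiv.ofBijective g hgb).symm, fun j => u ((Equiv.ofBijective g hgb).symm j), fun x j => ?_⟩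
  have := hgu ((Equiv.ofBijective g hgb).symm j) x
  rw [this, Equiv.ofBijective_apply_symm_apply g hgb j]

variable {I V} in
/-- Consequence: the direct sum metric of every decomposition is preserved.
[claim: Mochizuki2012, status: disputed] -/
theorem dsNormSq_induced {J : Type} [Fintype J] [DecidableEq J] (Φ : Decomposition I V J)
    (σ : I → V → (ℂ ≃ₗᵢ[ℝ] ℂ)) (x : MI I V) :
    dsNormSq Φ (induced I V σ x) = dsNormSq Φ x := by
  obtain ⟨e, u, he⟩ := preservesDecomposition_induced Φ σ
  rw [dsNormSq, dsNormSq, ← Equiv.sum_comp e]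
  simp only [he, LinearIsometryEquiv.norm_map]

variable {I V} in
/-- Consequence: the induced automorphisms map `B_I` into `B_I`. [claim: Mochizuki2012, status: disputed] -/
theorem mapsTo_ball_induced {J : Type} [Fintype J] [DecidableEq J] (Φ : Decomposition I V J)
    (σ : I → V → (ℂ ≃ₗᵢ[ℝ] ℂ)) : Set.MapsTo (induced I V σ) (ball Φ) (ball Φ) := by
  obtain ⟨e, u, he⟩ := preservesDecomposition_induced Φ σ
  intro x hx j
  obtain ⟨j', rfl⟩ := e.surjective j
  rw [he, LinearIsometryEquiv.norm_map]
  exact hx j'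

variable {I V} in
/-- Consequence: `F(B_I) = B_I` for every induced automorphism `F` (apply `mapsTo` to `F` and `F⁻¹`).
[claim: Mochizuki2012, status: disputed] -/
theorem image_ball_induced {J : Type} [Fintype J] [DecidableEq J] (Φ : Decomposition I V J)
    (σ : I → V → (ℂ ≃ₗᵢ[ℝ] ℂ)) : induced I V σ '' ball Φ = ball Φ := by
  refine Set.Subset.antisymm (mapsTo_ball_induced Φ σ).image_subset fun y hy => ?_
  refine ⟨induced I V (fun i v => (σ i v).symm) y, mapsTo_ball_induced Φ _ hy, ?_⟩
  have := induced_symm_apply I V (fun i v => (σ i v).symm) y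
  simpa using this

/-! ## `B_I` intrinsically: the unit ball of all characters (consumability, audit note F-Sd1-1) -/

variable {I V} in
/-- **`B_I` is intrinsic**: for EVERY direct sum decomposition `Φ`, `x ∈ B_I` iff `|χ_{w,ε}(x)| ≤ 1` for
all characters `χ_{w,ε}` of `M_I` — so consumers ([IUTchIV] Thm. 1.10, Step (vii)) may use `B_I`
without choosing a decomposition (suggested by abc-iut-S-d1's audit of the statement file; cf. its
`unitBalls`). [claim: Mochizuki2012, status: disputed] -/
theorem mem_ball_iff_forall_character {J : Type} [Fintype J] [DecidableEq J]
    (Φ : Decomposition I V J) (x : MI I V) :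
    x ∈ ball Φ ↔ ∀ (w : I → V) (ε : I → Bool), ‖character I V w ε x‖ ≤ 1 := by
  constructor
  · intro hx w ε
    -- the character, read through `Φ`, is `cj b ∘ (coordinate j)`
    obtain ⟨j, b, hj⟩ := algHom_pi_eq J ((character I V w ε).comp (Φ.symm : (J → ℂ) →ₐ[ℝ] MI I V))
    have h := hj (Φ x)
    simp only [AlgHom.comp_apply, AlgEquiv.coe_toAlgHom, AlgEquiv.symm_apply_apply] at h
    rw [h, norm_cj]
    exact hx j
  · intro hx j
    obtain ⟨w, ε, hj⟩ := exists_coord_eq_character Φ j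
    rw [hj]
    exact hx w ε

/-- **Prop. 1.5 (iii), invariance, holds** — for EVERY family of isometries `σ_{i,v}` of the summands
`ℂ_v` (in particular for the primitive automorphisms): the tensor product metric, every direct sum
decomposition, its direct sum metric and its integral structure `B_I` are preserved by the induced
automorphism of `M_I`. [claim: Mochizuki2012, status: disputed] -/
theorem prop15iii_preserved_holds : Prop15iii_preserved I V := by
  intro σ _
  refine ⟨fun B hB x y => tensorMetric_induced I V σ hB x y, fun J _ Φ => ?_⟩
  classical
  exact ⟨preservesDecomposition_induced Φ σ, fun x => dsNormSq_induced Φ σ x,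
    image_ball_induced Φ σ⟩

end Prop15iii

end Literature.IUT.LogVolume

end
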